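import Literature.NumberTheory.GaloisRepresentations.RayClassGroup
import Literature.NumberTheory.GaloisRepresentations.CyclotomicFrobenius
import HarnessLib

/-!
# The norm subgroup `𝒩_{L/K}(𝔪) ≤ J_K^𝔪` and "norms are killed by the Artin map" (Childress Ch. 5 Thm. 2.1 (iii))

Topic `NumberTheory/GaloisRepresentations` (class field theory, next to `RayClassGroup.lean` —
`idealsPrimeTo 𝔪 = J_K^𝔪`, `artinHom` — and `CyclotomicFrobenius.lean` — `galFrob`, `eq_galFrob`);
namespace `Literature.NumberTheory.GaloisRepresentations`.  Two small definitions (the prime power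
`𝔮^n` as an invertible fractional ideal, and the norm subgroup) with the theorems about them; everything
is proved.

## Source

N. Childress, *Class Field Theory*, Universitext, Springer 2009: Ch. 3 Thm. 2.6 (PDF p. 64):
"`𝒩_{K/F}(𝔪) = {𝔞 ∈ ℐ_F(𝔪) : 𝔞 = N_{K/F}(𝔄) for some 𝔄 in ℐ_K}`"; Ch. 5 §1 (PDF p. 114–115), the Artin
symbol and its consistency, and Thm. 2.1 (iii) (PDF p. 116): "`𝒩_{K/F}(𝔪) ⊆ ker(𝒜)` […] we have shown
(iii) already, as a corollary to the Consistency Property": for a prime `𝔓 ∣ 𝔭` of `K`, `𝔭` unramified,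
`N_{K/F} 𝔓 = 𝔭^{f(𝔓|𝔭)}` and `(𝔭, K/F)^{f} = 1`, the Frobenius generating the decomposition group of
order `f` (Childress Ch. 5 §1; Neukirch, *Algebraic Number Theory*, Ch. I §9 (9.4), Ch. VI §7 (7.2)–(7.3)).

## Contents

* `primePowUnit 𝔮 n = 𝔮ⁿ ∈ (FractionalIdeal (𝓞 K)⁰ K)ˣ`; `normSubgroup 𝔪 L ≤ (FractionalIdeal (𝓞 K)⁰ K)ˣ`
  — **`𝒩_{L/K}(𝔪)`**, the subgroup generated by the norms `N_{L/K} 𝔔 = 𝔮^{f(𝔔|𝔮)}`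
  (`Ideal.inertiaDeg`) of the primes `𝔔` of `L` above the primes `𝔮 ∤ 𝔪` of `K` (as `J_L^𝔪` is free
  on its primes, this is the group of all norms of fractional ideals of `L` prime to `𝔪`);
  `normSubgroup_le_idealsPrimeTo`: `𝒩_{L/K}(𝔪) ≤ J_K^𝔪`.
* `pow_smul_sub_pow_mem_of_isArithFrobAt_ringOfIntegers`, `pow_inertiaDeg_eq_one_of_isArithFrobAt` — **`Frob^f = 1`**:
  an arithmetic Frobenius `φ` at a prime `𝔔` of `𝓞 L` above an unramified `𝔮` satisfies
  `φ^{f(𝔔|𝔮)} = 1` (`φᵏ` acts on `𝓞_L/𝔔` as `x ↦ x^{qᵏ}`, the identity for `k = f`; so `φ^f` lies in the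
  inertia group, trivial at unramified `𝔮`).
* `normSubgroup_le_ker_artinHom` — **Thm. 2.1 (iii): `𝒩_{L/K}(𝔪) ≤ ker 𝒜`** for the Artin
  homomorphism of the Frobenius datum `𝔮 ↦ χ(Frob_𝔮)` of an abelian `L/K` (any `χ : Gal(L/K) →* G`,
  `G` commutative), granted that the primes `𝔮 ∤ 𝔪` are unramified in `L`.

Input D4 of the tree's discharge plan for `artinReciprocity_rankOne` (with `ArtinMapKernelGlue.lean`,
`H = ray 𝔪 ⊔ normSubgroup 𝔪 L`).

## References

* N. Childress, *Class Field Theory*, Universitext, Springer 2009, Ch. 3 §2 Thm. 2.6; Ch. 5 §1 and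
  Thm. 2.1 (iii) (PDF pp. 64, 114–116). [Childress2009]
* J. Neukirch, *Algebraic Number Theory*, Springer 1999, Ch. I §9 (9.4); Ch. VI §7 (7.2)–(7.3).
  [NeukirchANT1999]
-/

noncomputable section

open NumberField IsDedekindDomain

open scoped nonZeroDivisors

namespace Literature.NumberTheory.GaloisRepresentations

/-! ### `Frob^f = 1` -/

section FrobPow

variable {K L : Type*} [Field K] [Field L] [Algebra K L] [NumberField K] [NumberField L]
  [IsGalois K L]

/-- **Iterates of a Frobenius**: if `φ x ≡ x^q (mod 𝔔)` for all `x`, then `φᵏ x ≡ x^{qᵏ} (mod 𝔔)`.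
[folklore] -/
theorem pow_smul_sub_pow_mem_of_isArithFrobAt_ringOfIntegers {Q : Ideal (𝓞 L)} {φ : L ≃ₐ[K] L}
    (hφ : IsArithFrobAt (𝓞 K) φ Q) (k : ℕ) (x : 𝓞 L) :
    (φ ^ k) • x - x ^ (Nat.card (𝓞 K ⧸ Q.under (𝓞 K)) ^ k) ∈ Q := by
  induction k with
  | zero => simp
  | succ k ih =>
    set q := Nat.card (𝓞 K ⧸ Q.under (𝓞 K)) with hq
    rw [pow_succ', mul_smul, pow_succ, pow_mul]
    have h1 : φ • ((φ ^ k) • x) - ((φ ^ k) • x) ^ q ∈ Q := by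
      have h := hφ ((φ ^ k) • x)
      rwa [MulSemiringAction.toAlgHom_apply] at h
    have h2 : ((φ ^ k) • x) ^ q - (x ^ q ^ k) ^ q ∈ Q :=
      Ideal.mem_of_dvd Q (sub_dvd_pow_sub_pow _ _ q) ih
    have h3 := Q.add_mem h1 h2
    rwa [sub_add_sub_cancel] at h3

/-- **`Frob^f = 1` at an unramified prime**: an arithmetic Frobenius `φ ∈ Gal(L/K)` at a prime `𝔔` of
`𝓞 L` above `𝔮`, `𝔮` unramified in `L`, satisfies `φ^{f(𝔔|𝔮)} = 1` (`φ^f` induces `x ↦ x^{q^f} = x` on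
the residue field `𝓞_L/𝔔` of order `q^f`, so lies in the inertia group, which is trivial).  Ref:
Neukirch, *Algebraic Number Theory*, Ch. I §9 (9.4) (the Frobenius generates the decomposition group,
of order `f`); Childress Ch. 5 §1. [cite: NeukirchANT1999, Ch. I §9 Prop. (9.4)] -/
theorem pow_inertiaDeg_eq_one_of_isArithFrobAt {𝔮 : HeightOneSpectrum (𝓞 K)}
    (hunr : Algebra.IsUnramifiedIn (𝓞 L) 𝔮.asIdeal) {Q : Ideal (𝓞 L)}
    (hQ : Q ∈ 𝔮.asIdeal.primesOver (𝓞 L)) {φ : L ≃ₐ[K] L} (hφ : IsArithFrobAt (𝓞 K) φ Q) :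
    φ ^ Q.inertiaDeg (𝓞 K) = 1 := by
  haveI := hQ.1
  haveI := hQ.2
  haveI := 𝔮.isMaximal
  have hQne : Q ≠ ⊥ := Ideal.ne_bot_of_mem_primesOver 𝔮.ne_bot hQ
  haveI hQmax : Q.IsMaximal := Ideal.IsPrime.isMaximal hQ.1 hQne
  have hunder : Q.under (𝓞 K) = 𝔮.asIdeal := hQ.2.over.symm
  -- `q^f = #(𝓞 L ⧸ Q)`
  have hcard : Nat.card (𝓞 K ⧸ Q.under (𝓞 K)) ^ Q.inertiaDeg (𝓞 K) = Nat.card (𝓞 L ⧸ Q) := by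
    have h := Ideal.cardQuot_pow_inertiaDeg (𝔮.asIdeal) Q (R := 𝓞 K)
    rw [Submodule.cardQuot_apply, Submodule.cardQuot_apply] at h
    rw [hunder]
    exact h
  have hmem : φ ^ Q.inertiaDeg (𝓞 K) ∈ Q.inertia (L ≃ₐ[K] L) := by
    intro x
    have h := pow_smul_sub_pow_mem_of_isArithFrobAt_ringOfIntegers hφ (Q.inertiaDeg (𝓞 K)) x
    rw [hcard] at h
    have hfrob : x ^ Nat.card (𝓞 L ⧸ Q) - x ∈ Q := by
      rw [← Ideal.Quotient.eq, map_pow]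
      letI := Ideal.Quotient.field Q
      haveI : Finite (𝓞 L ⧸ Q) := Ideal.finiteQuotientOfFreeOfNeBot Q hQne
      letI : Fintype (𝓞 L ⧸ Q) := Fintype.ofFinite _
      rw [Nat.card_eq_fintype_card]
      exact FiniteField.pow_card _
    have h3 := Q.add_mem h hfrob
    rwa [sub_add_sub_cancel] at h3
  rw [inertia_eq_bot_of_isUnramifiedIn hunr hQ, Subgroup.mem_bot] at hmem
  exact hmem

end FrobPow

/-! ### The norm subgroup `𝒩_{L/K}(𝔪)` -/

section NormSubgroup

variable {K : Type*} [Field K] [NumberField K]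

/-- The prime power `𝔮ⁿ` as an invertible fractional ideal. [folklore] -/
def primePowUnit (𝔮 : HeightOneSpectrum (𝓞 K)) (n : ℕ) : (FractionalIdeal (𝓞 K)⁰ K)ˣ :=
  Units.mk0 ((𝔮.asIdeal : Ideal (𝓞 K)) : FractionalIdeal (𝓞 K)⁰ K) (coeIdeal_ne_zero_of_ne_bot 𝔮.ne_bot) ^ n

/-- Unfolding lemma for `primePowUnit`. [folklore] -/
theorem primePowUnit_def (𝔮 : HeightOneSpectrum (𝓞 K)) (n : ℕ) :
    primePowUnit 𝔮 n =
      Units.mk0 ((𝔮.asIdeal : Ideal (𝓞 K)) : FractionalIdeal (𝓞 K)⁰ K)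
        (coeIdeal_ne_zero_of_ne_bot 𝔮.ne_bot) ^ n :=
  rfl

variable (𝔪 : Ideal (𝓞 K)) (L : Type*) [Field L] [NumberField L] [Algebra K L]

/-- **The norm subgroup `𝒩_{L/K}(𝔪)`**: the subgroup of the invertible fractional ideals of `K`
generated by the norms `N_{L/K} 𝔔 = 𝔮^{f(𝔔|𝔮)}` of the primes `𝔔` of `𝓞 L` lying over the primes
`𝔮 ∤ 𝔪` of `K` (equivalently, the norms of all fractional ideals of `L` prime to `𝔪`, since `J_L^𝔪`
is free on its primes).  Ref: Childress, *Class Field Theory*, Ch. 3 Thm. 2.6 ("`𝒩_{K/F}(𝔪) =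
{𝔞 ∈ ℐ_F(𝔪) : 𝔞 = N_{K/F}(𝔄)}`"); Neukirch VI (7.1) (`H^𝔪 = (N_{L|K} J_L^𝔪) P_K^𝔪`).
[cite: Childress2009, Ch. 3 §2 Thm. 2.6 (PDF p. 64)] -/
def normSubgroup : Subgroup (FractionalIdeal (𝓞 K)⁰ K)ˣ :=
  Subgroup.closure {u | ∃ 𝔮 : HeightOneSpectrum (𝓞 K), ¬ 𝔪 ≤ 𝔮.asIdeal ∧
    ∃ Q ∈ 𝔮.asIdeal.primesOver (𝓞 L), u = primePowUnit 𝔮 (Q.inertiaDeg (𝓞 K))}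

variable {𝔪 L}

/-- A prime power `𝔮ⁿ`, `𝔮 ∤ 𝔪`, lies in `J_K^𝔪`. [folklore] -/
theorem primePowUnit_mem_idealsPrimeTo {𝔮 : HeightOneSpectrum (𝓞 K)} (h𝔮 : ¬ 𝔪 ≤ 𝔮.asIdeal) (n : ℕ) :
    primePowUnit 𝔮 n ∈ idealsPrimeTo 𝔪 := by
  refine Subgroup.pow_mem _ ?_ n
  intro v hv
  have hne : 𝔮 ≠ v := fun h => h𝔮 (h ▸ hv)
  rw [Units.val_mk0]
  exact FractionalIdeal.count_maximal_coprime K v hne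

omit [NumberField L] in
/-- **`𝒩_{L/K}(𝔪) ≤ J_K^𝔪`.** [cite: Childress2009, Ch. 3 §2 Thm. 2.6 (PDF p. 64)] -/
theorem normSubgroup_le_idealsPrimeTo : normSubgroup 𝔪 L ≤ idealsPrimeTo 𝔪 := by
  rw [normSubgroup, Subgroup.closure_le]
  rintro u ⟨𝔮, h𝔮, Q, -, rfl⟩
  exact primePowUnit_mem_idealsPrimeTo h𝔮 _

/-- The Artin homomorphism on a prime power: `A(𝔮ⁿ) = f(𝔮)ⁿ`. [folklore] -/
theorem artinHom_primePowUnit {G : Type*} [CommGroup G] (f : HeightOneSpectrum (𝓞 K) → G)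
    (𝔮 : HeightOneSpectrum (𝓞 K)) (n : ℕ) : artinHom f (primePowUnit 𝔮 n) = f 𝔮 ^ n := by
  rw [primePowUnit_def, map_pow, artinHom_unitsMk0_coeIdeal f 𝔮.ne_bot,
    LFunctions.AbelianDensity.artinSymbol_asIdeal]

/-- **Norms are killed by the Artin map** (Childress, *Class Field Theory*, Ch. 5, Thm. 2.1 (iii):
"`𝒩_{K/F}(𝔪) ⊆ ker(𝒜)`", a corollary of the consistency property).  For an abelian extension `L/K`,
a homomorphism `χ : Gal(L/K) → G` to a commutative group and the Frobenius datum `𝔮 ↦ χ(Frob_𝔮)`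
(`galFrob`), the Artin homomorphism kills `𝒩_{L/K}(𝔪)`, provided the primes `𝔮 ∤ 𝔪` are unramified
in `L`: on a generator `N 𝔔 = 𝔮^{f(𝔔|𝔮)}` its value is `χ(Frob_𝔮)^f = χ(Frob_𝔮^f) = 1`
(`pow_inertiaDeg_eq_one_of_isArithFrobAt`, the Frobenius at `𝔔` being `Frob_𝔮`, `eq_galFrob`).
[cite: Childress2009, Ch. 5 §2 Thm. 2.1 (iii) (PDF p. 116)] -/
theorem normSubgroup_le_ker_artinHom [IsGalois K L] (hcomm : ∀ a b : L ≃ₐ[K] L, Commute a b)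
    {G : Type*} [CommGroup G] (χ : (L ≃ₐ[K] L) →* G)
    (hunr : ∀ 𝔮 : HeightOneSpectrum (𝓞 K), ¬ 𝔪 ≤ 𝔮.asIdeal → Algebra.IsUnramifiedIn (𝓞 L) 𝔮.asIdeal) :
    normSubgroup 𝔪 L ≤ (artinHom fun v => χ (galFrob K L v)).ker := by
  rw [normSubgroup, Subgroup.closure_le]
  rintro u ⟨𝔮, h𝔮, Q, hQ, rfl⟩
  rw [SetLike.mem_coe, MonoidHom.mem_ker, artinHom_primePowUnit, ← map_pow]
  haveI := hQ.1
  obtain ⟨φ, hφ⟩ := exists_isArithFrobAt_ringOfIntegers (M := K) Q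
    (Ideal.ne_bot_of_mem_primesOver 𝔮.ne_bot hQ)
  have heq : φ = galFrob K L 𝔮 := eq_galFrob hcomm (hunr 𝔮 h𝔮) hQ hφ
  rw [← heq, pow_inertiaDeg_eq_one_of_isArithFrobAt (hunr 𝔮 h𝔮) hQ hφ, map_one]

end NormSubgroup

end Literature.NumberTheory.GaloisRepresentations
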